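import Mathlib
import HarnessLib

/-!
# Saddle geometry on the fugacity torus, part 2: the complex critical point

Helper file for route `TcThermcert1`, crux `ThermalStiffnessCeilingU8b10_le_1o8` (item `stmt-Ventures-26381`), line
`Cruxes/ThermalStiffnessCeilingU8b10_le_1o8/Lines/zerofree_corridor.lean` v8, registered stub `stub_saddleGeometry` (K3b).

The stub asks for a base point `(φ₀, ψ₀)` on the torus `|z| = r₁`, `|w| = r₂` at which the exponent
`Φ = log(1+z) + log(1+w) + h(z,w) − (a/M) log z − (b/M) log w` has NO linear term.  Writing `z = r₁e^{i(φ₀+u)}`, the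
`u`-derivative of `Φ` is `i·(z/(1+z) + z∂_z h − a/M)`, so the base point is a solution `(z₀, w₀) ∈ ℂ²` of the perturbed saddle
equations `z/(1+z) + P₁(z,w) = α`, `w/(1+w) + P₂(z,w) = β` with `P₁ = z∂_z h`, `P₂ = w∂_w h`, `α = a/M`, `β = b/M`, and then
`r₁ = |z₀|`, `φ₀ = arg z₀` (similarly for `w₀`).  This file solves those equations model-free:

* `exists_perturbed_saddle_point`: if `‖α − 7/16‖, ‖β − 7/16‖ ≤ 1/300` and `P₁, P₂` are bounded by `1/300` and `λ`-Lipschitz with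
  `λ ≤ 1/10` (sup norm of `ℂ × ℂ`) on the closed bidisc `D` of radius `1/18` about `(7/9, 7/9)`, there is a solution in `D`
  (Banach's fixed point theorem for `(z,w) ↦ (g⁻¹(α − P₁), g⁻¹(β − P₂))`, `g⁻¹(t) = t/(1−t)`, contraction constant `1/3`);
* `norm_fst_mem_of_mem_bidisc` / `norm_snd_mem_of_mem_bidisc`: points of `D` have both moduli in `[13/18, 15/18] ⊂ (2/3, 8/9)`,
  so the radii `r₁ = |z₀|`, `r₂ = |w₀|` are admissible in the stub.

The unperturbed saddle is `z = w = 7/9` (`g(7/9) = 7/16`, the sector density of the line).  [folklore] No definitions; no `sorry`.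
-/

noncomputable section

open Complex Metric Set

namespace Summit.Ventures.CertifiedManyBodySolver.Theorems.TcThermcert1.ZeroFreeCorridor

/-! ## §3 The complex critical point: a fixed point in the bidisc around `(7/9, 7/9)` -/

/-- For `‖t − 7/16‖ ≤ 1/150`: `‖1 − t‖ ≥ 5/9`. -/
theorem norm_one_sub_ge_of_near {t : ℂ} (ht : ‖t - 7 / 16‖ ≤ 1 / 150) : 5 / 9 ≤ ‖1 - t‖ := by
  have h1 : ‖(1 : ℂ) - 7 / 16‖ = 9 / 16 := by
    rw [show (1 : ℂ) - 7 / 16 = ((9 / 16 : ℝ) : ℂ) by push_cast; norm_num, Complex.norm_real]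
    norm_num
  have h2 : ‖(1 : ℂ) - 7 / 16‖ ≤ ‖1 - t‖ + ‖t - 7 / 16‖ := by
    calc ‖(1 : ℂ) - 7 / 16‖ = ‖(1 - t) + (t - 7 / 16)‖ := by ring_nf
      _ ≤ ‖1 - t‖ + ‖t - 7 / 16‖ := norm_add_le _ _
  linarith

/-- The inverse Möbius map `t ↦ t/(1−t)` sends the disc `‖t − 7/16‖ ≤ 1/150` into the disc `‖z − 7/9‖ ≤ 1/18`. -/
theorem norm_moebiusInv_sub_le {t : ℂ} (ht : ‖t - 7 / 16‖ ≤ 1 / 150) : ‖t / (1 - t) - 7 / 9‖ ≤ 1 / 18 := by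
  have h59 := norm_one_sub_ge_of_near ht
  have hne : (1 : ℂ) - t ≠ 0 := fun h => by rw [h, norm_zero] at h59; norm_num at h59
  have e : t / (1 - t) - 7 / 9 = 16 / 9 * (t - 7 / 16) / (1 - t) := by
    field_simp
    ring
  rw [e, norm_div, norm_mul, show ‖(16 / 9 : ℂ)‖ = 16 / 9 by
    rw [show (16 / 9 : ℂ) = ((16 / 9 : ℝ) : ℂ) by push_cast; rfl, Complex.norm_real]; norm_num]
  rw [div_le_iff₀ (by linarith)]
  nlinarith

/-- Lipschitz bound of the inverse Möbius map on the disc `‖t − 7/16‖ ≤ 1/150`: constant `81/25`. -/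
theorem norm_moebiusInv_sub_moebiusInv_le {t t' : ℂ} (ht : ‖t - 7 / 16‖ ≤ 1 / 150) (ht' : ‖t' - 7 / 16‖ ≤ 1 / 150) :
    ‖t / (1 - t) - t' / (1 - t')‖ ≤ 81 / 25 * ‖t - t'‖ := by
  have h59 := norm_one_sub_ge_of_near ht
  have h59' := norm_one_sub_ge_of_near ht'
  have hne : (1 : ℂ) - t ≠ 0 := fun h => by rw [h, norm_zero] at h59; norm_num at h59
  have hne' : (1 : ℂ) - t' ≠ 0 := fun h => by rw [h, norm_zero] at h59'; norm_num at h59'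
  have e : t / (1 - t) - t' / (1 - t') = (t - t') / ((1 - t) * (1 - t')) := by
    field_simp
    ring
  rw [e, norm_div, norm_mul, div_le_iff₀ (by positivity)]
  have hprod : 25 / 81 ≤ ‖1 - t‖ * ‖1 - t'‖ := by nlinarith
  nlinarith [norm_nonneg (t - t')]

/-- `z ↦ z/(1+z)` inverts `t ↦ t/(1−t)` (`t ≠ 1`). -/
theorem moebius_moebiusInv {t : ℂ} (ht : 1 - t ≠ 0) : t / (1 - t) / (1 + t / (1 - t)) = t := by
  field_simp
  ring

/-- **§3 — the complex critical point.** Let `D` be the closed bidisc of radius `1/18` around `(7/9, 7/9)`.  If the targets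
`α, β` are within `1/300` of `7/16` and the perturbations `P₁, P₂` are bounded by `1/300` and `λ`-Lipschitz (`λ ≤ 1/10`, sup-norm
on `ℂ × ℂ`) on `D`, then the perturbed saddle equations `z/(1+z) + P₁(z,w) = α`, `w/(1+w) + P₂(z,w) = β` have a solution in `D`
(Banach's fixed point theorem for `(z,w) ↦ (g⁻¹(α − P₁), g⁻¹(β − P₂))`, `g⁻¹(t) = t/(1−t)`, contraction constant `1/3`). -/
theorem exists_perturbed_saddle_point (α β : ℂ) (hα : ‖α - 7 / 16‖ ≤ 1 / 300) (hβ : ‖β - 7 / 16‖ ≤ 1 / 300)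
    (P₁ P₂ : ℂ × ℂ → ℂ) {lam : ℝ} (hlam : lam ≤ 1 / 10)
    (hP₁ : ∀ p ∈ closedBall (7 / 9 : ℂ) (1 / 18) ×ˢ closedBall (7 / 9 : ℂ) (1 / 18), ‖P₁ p‖ ≤ 1 / 300)
    (hP₂ : ∀ p ∈ closedBall (7 / 9 : ℂ) (1 / 18) ×ˢ closedBall (7 / 9 : ℂ) (1 / 18), ‖P₂ p‖ ≤ 1 / 300)
    (hL₁ : ∀ p ∈ closedBall (7 / 9 : ℂ) (1 / 18) ×ˢ closedBall (7 / 9 : ℂ) (1 / 18),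
      ∀ q ∈ closedBall (7 / 9 : ℂ) (1 / 18) ×ˢ closedBall (7 / 9 : ℂ) (1 / 18), ‖P₁ p - P₁ q‖ ≤ lam * ‖p - q‖)
    (hL₂ : ∀ p ∈ closedBall (7 / 9 : ℂ) (1 / 18) ×ˢ closedBall (7 / 9 : ℂ) (1 / 18),
      ∀ q ∈ closedBall (7 / 9 : ℂ) (1 / 18) ×ˢ closedBall (7 / 9 : ℂ) (1 / 18), ‖P₂ p - P₂ q‖ ≤ lam * ‖p - q‖) :
    ∃ p ∈ closedBall (7 / 9 : ℂ) (1 / 18) ×ˢ closedBall (7 / 9 : ℂ) (1 / 18),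
      1 - (α - P₁ p) ≠ 0 ∧ 1 - (β - P₂ p) ≠ 0 ∧
      p.1 = (α - P₁ p) / (1 - (α - P₁ p)) ∧ p.2 = (β - P₂ p) / (1 - (β - P₂ p)) ∧
      p.1 / (1 + p.1) + P₁ p = α ∧ p.2 / (1 + p.2) + P₂ p = β := by
  set D := closedBall (7 / 9 : ℂ) (1 / 18) ×ˢ closedBall (7 / 9 : ℂ) (1 / 18) with hD
  set T : ℂ × ℂ → ℂ × ℂ := fun p => ((α - P₁ p) / (1 - (α - P₁ p)), (β - P₂ p) / (1 - (β - P₂ p))) with hT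
  -- the shifted targets stay within `1/150` of `7/16`
  have htar : ∀ p ∈ D, ‖(α - P₁ p) - 7 / 16‖ ≤ 1 / 150 ∧ ‖(β - P₂ p) - 7 / 16‖ ≤ 1 / 150 := by
    intro p hp
    constructor
    · calc ‖(α - P₁ p) - 7 / 16‖ = ‖(α - 7 / 16) - P₁ p‖ := by ring_nf
        _ ≤ ‖α - 7 / 16‖ + ‖P₁ p‖ := norm_sub_le _ _
        _ ≤ 1 / 150 := by linarith [hP₁ p hp]
    · calc ‖(β - P₂ p) - 7 / 16‖ = ‖(β - 7 / 16) - P₂ p‖ := by ring_nf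
        _ ≤ ‖β - 7 / 16‖ + ‖P₂ p‖ := norm_sub_le _ _
        _ ≤ 1 / 150 := by linarith [hP₂ p hp]
  have hmaps : MapsTo T D D := by
    intro p hp
    refine ⟨mem_closedBall.mpr ?_, mem_closedBall.mpr ?_⟩
    · rw [dist_eq_norm]; exact norm_moebiusInv_sub_le (htar p hp).1
    · rw [dist_eq_norm]; exact norm_moebiusInv_sub_le (htar p hp).2
  have hlip : LipschitzOnWith (1 / 3 : NNReal) T D := by
    refine LipschitzOnWith.of_dist_le_mul fun p hp q hq => ?_
    rw [dist_eq_norm, dist_eq_norm, Prod.norm_def]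
    have hK : ((1 / 3 : NNReal) : ℝ) = 1 / 3 := by norm_num
    rw [hK]
    have hpq := norm_nonneg (p - q)
    refine max_le ?_ ?_
    · calc ‖(T p).1 - (T q).1‖ = ‖(α - P₁ p) / (1 - (α - P₁ p)) - (α - P₁ q) / (1 - (α - P₁ q))‖ := rfl
        _ ≤ 81 / 25 * ‖(α - P₁ p) - (α - P₁ q)‖ := norm_moebiusInv_sub_moebiusInv_le (htar p hp).1 (htar q hq).1
        _ = 81 / 25 * ‖P₁ q - P₁ p‖ := by congr 1; ring_nf
        _ ≤ 81 / 25 * (lam * ‖q - p‖) := by gcongr; exact hL₁ q hq p hp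
        _ = 81 / 25 * lam * ‖p - q‖ := by rw [norm_sub_rev]; ring
        _ ≤ 1 / 3 * ‖p - q‖ := by nlinarith
    · calc ‖(T p).2 - (T q).2‖ = ‖(β - P₂ p) / (1 - (β - P₂ p)) - (β - P₂ q) / (1 - (β - P₂ q))‖ := rfl
        _ ≤ 81 / 25 * ‖(β - P₂ p) - (β - P₂ q)‖ := norm_moebiusInv_sub_moebiusInv_le (htar p hp).2 (htar q hq).2
        _ = 81 / 25 * ‖P₂ q - P₂ p‖ := by congr 1; ring_nf
        _ ≤ 81 / 25 * (lam * ‖q - p‖) := by gcongr; exact hL₂ q hq p hp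
        _ = 81 / 25 * lam * ‖p - q‖ := by rw [norm_sub_rev]; ring
        _ ≤ 1 / 3 * ‖p - q‖ := by nlinarith
  have hsc : IsComplete D := (isClosed_closedBall.prod isClosed_closedBall).isComplete
  have hc : ((7 / 9 : ℂ), (7 / 9 : ℂ)) ∈ D :=
    ⟨mem_closedBall_self (by norm_num), mem_closedBall_self (by norm_num)⟩
  have hcw : ContractingWith (1 / 3 : NNReal) (hmaps.restrict T D D) :=
    ⟨by rw [← NNReal.coe_lt_coe]; norm_num, hlip.mapsToRestrict hmaps⟩
  obtain ⟨p, hpD, hfix, -⟩ := hcw.exists_fixedPoint' hsc hmaps hc (edist_ne_top _ _)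
  have hne1 : 1 - (α - P₁ p) ≠ 0 := fun h => by
    have := norm_one_sub_ge_of_near (htar p hpD).1; rw [h, norm_zero] at this; norm_num at this
  have hne2 : 1 - (β - P₂ p) ≠ 0 := fun h => by
    have := norm_one_sub_ge_of_near (htar p hpD).2; rw [h, norm_zero] at this; norm_num at this
  have h1 : p.1 = (α - P₁ p) / (1 - (α - P₁ p)) := (congrArg Prod.fst hfix).symm
  have h2 : p.2 = (β - P₂ p) / (1 - (β - P₂ p)) := (congrArg Prod.snd hfix).symm
  refine ⟨p, hpD, hne1, hne2, h1, h2, ?_, ?_⟩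
  · rw [h1, moebius_moebiusInv hne1]; ring
  · rw [h2, moebius_moebiusInv hne2]; ring

/-- Points of the bidisc have first modulus in `[13/18, 15/18]`, inside the fugacity annulus `(2/3, 8/9)`. -/
theorem norm_fst_mem_of_mem_bidisc {p : ℂ × ℂ}
    (hp : p ∈ closedBall (7 / 9 : ℂ) (1 / 18) ×ˢ closedBall (7 / 9 : ℂ) (1 / 18)) :
    2 / 3 < ‖p.1‖ ∧ ‖p.1‖ < 8 / 9 := by
  have h1 : ‖p.1 - 7 / 9‖ ≤ 1 / 18 := by rw [← dist_eq_norm]; exact mem_closedBall.mp hp.1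
  have h79 : ‖(7 / 9 : ℂ)‖ = 7 / 9 := by
    rw [show (7 / 9 : ℂ) = ((7 / 9 : ℝ) : ℂ) by push_cast; rfl, Complex.norm_real]; norm_num
  have hu : ‖p.1‖ ≤ ‖p.1 - 7 / 9‖ + ‖(7 / 9 : ℂ)‖ := by
    calc ‖p.1‖ = ‖(p.1 - 7 / 9) + 7 / 9‖ := by ring_nf
      _ ≤ _ := norm_add_le _ _
  have hl : ‖(7 / 9 : ℂ)‖ ≤ ‖p.1 - 7 / 9‖ + ‖p.1‖ := by
    calc ‖(7 / 9 : ℂ)‖ = ‖p.1 - (p.1 - 7 / 9)‖ := by ring_nf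
      _ ≤ ‖p.1‖ + ‖p.1 - 7 / 9‖ := norm_sub_le _ _
      _ = _ := add_comm _ _
  constructor <;> linarith

/-- Points of the bidisc have second modulus in `[13/18, 15/18]`, inside the fugacity annulus `(2/3, 8/9)`. -/
theorem norm_snd_mem_of_mem_bidisc {p : ℂ × ℂ}
    (hp : p ∈ closedBall (7 / 9 : ℂ) (1 / 18) ×ˢ closedBall (7 / 9 : ℂ) (1 / 18)) :
    2 / 3 < ‖p.2‖ ∧ ‖p.2‖ < 8 / 9 :=
  norm_fst_mem_of_mem_bidisc (p := (p.2, p.1)) ⟨hp.2, hp.1⟩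

end Summit.Ventures.CertifiedManyBodySolver.Theorems.TcThermcert1.ZeroFreeCorridor

end
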